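import Literature.NumberTheory.ModularForms.LevelOneHeckeRingPrimeGenerators
import Literature.NumberTheory.ModularForms.LevelOneCuspFormDimensionFormula
import HarnessLib

/-!
# The Hecke rings of small weight: `𝕋_ℤ(S_k(SL₂(ℤ))) = ℤ` (`k ≤ 22`, `k = 26`), `= ℤ[T(2)]` (`k ≤ 34`, `k = 38`),
# `= ℤ[T(2), T(3)]` (`k ≤ 46`, `k = 50`)

J.-P. Serre, *A Course in Arithmetic*, Ch. VII §5.3 Cor. 1 ("the `T(n)` are polynomials in the `T(p)`") and §5.5
(Prop. 14 and Remark: for `k = 12, 16, 18, 20, 22, 26` the space `S_k` has dimension `1` and every `T(n)` acts by an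
integer); B. Edixhoven, Thm. 2.5.11 (`𝕋` is generated by the `T(n)`, `n ≤` Sturm bound).  Combining the ring
generation theorem `𝕋_ℤ = ℤ[T(p) : p prime, p ≤ dim S_k]` (`LevelOneHeckeRingPrimeGenerators`) with the dimension
formula (`LevelOneCuspFormDimensionFormula`):

* ★ **`levelOneHeckeRing_eq_bot_of_weight_le`** (`k ≤ 22` or `k = 26`: `𝕋_ℤ = ℤ`),
  ★ **`levelOneHeckeRing_eq_adjoin_heckeT_two_of_weight_le`** (`k ≤ 34` or `k = 38`: `𝕋_ℤ = ℤ[T(2)]`),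
  `levelOneHeckeRing_eq_adjoin_heckeT_two_three_of_weight_le` (`k ≤ 46` or `k = 50`: `𝕋_ℤ = ℤ[T(2), T(3)]`),
  `heckeTCuspₗ_mem_adjoin_heckeT_two_of_weight_le`.

No named facts; no new definitions.

## References

* [Serre1973] J.-P. Serre, *A Course in Arithmetic*, GTM 7 (1973), Ch. VII §5.3 Cor. 1, §5.5.
* [Edixhoven2011] B. Edixhoven, Ch. 2 of *Computational Aspects of Modular Forms and Galois Representations*,
  Ann. of Math. Stud. 176 (2011), Thm. 2.5.11.
-/

noncomputable section

open scoped MatrixGroups ModularForm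
open UpperHalfPlane hiding I

namespace Literature.NumberTheory.ModularForms

/-! ## The Hecke rings of small weight -/

section SmallWeight

/-- ★ **`𝕋_ℤ(S_k(SL₂(ℤ))) = ℤ` for `k ≤ 22` and `k = 26`** (`dim S_k ≤ 1`: every `T(n)` acts as the integer `τ_k(n)`).
[cite: Serre1973, Ch. VII §5.5 (Prop. 14 and Remark)] [cite: Edixhoven2011, Thm. 2.5.11] -/
theorem levelOneHeckeRing_eq_bot_of_weight_le {k : ℤ} (hk : k ≤ 22 ∨ k = 26) : levelOneHeckeRing k = ⊥ :=
  levelOneHeckeRing_eq_bot_of_finrank_le_one (finrank_cuspForm_le_one_of_weight hk)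

/-- ★ **`𝕋_ℤ(S_k(SL₂(ℤ))) = ℤ[T(2)]` for `k ≤ 34` and `k = 38`** (`dim S_k ≤ 2`). [cite: Serre1973, Ch. VII §5.3
Cor. 1] [cite: Edixhoven2011, Thm. 2.5.11] -/
theorem levelOneHeckeRing_eq_adjoin_heckeT_two_of_weight_le {k : ℤ} (hk : k ≤ 34 ∨ k = 38) :
    levelOneHeckeRing k = Algebra.adjoin ℤ {heckeTCuspₗ (k := k) two_pos} :=
  levelOneHeckeRing_eq_adjoin_heckeT_two_of_finrank_le_two (finrank_cuspForm_le_two_of_weight hk)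

/-- **`𝕋_ℤ(S_k(SL₂(ℤ))) = ℤ[T(2), T(3)]` for `k ≤ 46` and `k = 50`** (`dim S_k ≤ 3`). [cite: Serre1973, Ch. VII
§5.3 Cor. 1] [cite: Edixhoven2011, Thm. 2.5.11] -/
theorem levelOneHeckeRing_eq_adjoin_heckeT_two_three_of_weight_le {k : ℤ} (hk : k ≤ 46 ∨ k = 50) :
    levelOneHeckeRing k = Algebra.adjoin ℤ {heckeTCuspₗ (k := k) two_pos, heckeTCuspₗ (k := k) three_pos} :=
  levelOneHeckeRing_eq_adjoin_heckeT_two_three_of_finrank_le_three (finrank_cuspForm_le_three_of_weight hk)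

/-- **For `k ≤ 34` or `k = 38`, every Hecke operator `T(m)` on `S_k(SL₂(ℤ))` is an integer polynomial in `T(2)`.**
[cite: Serre1973, Ch. VII §5.3 Cor. 1] [cite: Edixhoven2011, Thm. 2.5.11] -/
theorem heckeTCuspₗ_mem_adjoin_heckeT_two_of_weight_le {k : ℤ} (hk : k ≤ 34 ∨ k = 38) {m : ℕ} (hm : 0 < m) :
    heckeTCuspₗ (k := k) hm ∈ Algebra.adjoin ℤ {heckeTCuspₗ (k := k) two_pos} := by
  rw [← levelOneHeckeRing_eq_adjoin_heckeT_two_of_weight_le hk]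
  exact heckeTCuspₗ_mem_levelOneHeckeRing hm

end SmallWeight

end Literature.NumberTheory.ModularForms
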